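import Literature.Probability.RandomPlanarGeometry.RestrictionSemigroup
import Literature.Probability.RandomPlanarGeometry.ConformalMapProofs
import Literature.Analysis.Complex.HydrodynamicCapacity
import Literature.Analysis.Complex.SchwarzReflection
import Literature.Analysis.Complex.HalfPlaneRigidity
import Mathlib.Analysis.SpecialFunctions.Complex.Arg
import HarnessLib

/-!
# Hydrodynamically normalized conformal maps `g : ℍ ∖ K → ℍ` and their half-plane capacity

G. F. Lawler, *Conformally Invariant Processes in the Plane*, AMS (2005), §3.4: for a bounded
hull `A` of the upper half-plane, `g_A` is "the unique conformal transformation of `ℍ ∖ A` onto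
`ℍ` such that `g_A(z) - z → 0` as `z → ∞`" (Prop. 3.36), `hcap(A) = lim z (g_A(z) - z)`
(Def. 3.37), and §3.4 proves `Im g_A(z) ≤ Im z`, (3.8) `hcap > 0` for nonempty hulls, the
additivity `hcap(A ∪ g_A⁻¹(B)) = hcap(A) + hcap(B)` (3.8)/(3.10), (3.9) `hcap(A) ≤ rad(A)²`,
(3.12) `|g_A(z) - z| ≤ 3 rad(A)` and Prop. 3.46, all with Brownian motion. This file develops
the same theory FUNCTION-THEORETICALLY for an abstract conformal equivalence
`φ : ℍ ∖ K → ℍ` with the hydrodynamic normalization (`Literature.Probability.RandomPlanarGeometry.IsHydrodynamicMap K φ`: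
`φ(z) - z → 0` at `∞` in `ℍ ∖ K`), the form needed for Loewner's slit theorem (where the
intermediate maps `g_t ∘ g_s⁻¹` are given abstractly). Throughout `K ∩ ℍ` is bounded.

* properness and bounds (`norm_le_of_norm_le`, `tendsto_symm_sub_self`), **`Im φ ≤ Im`**
  (`im_le`, from the boundary Julia lemma `Complex.im_le_im_of_tendsto_sub_self` for `φ⁻¹`),
  boundary behaviour `Im φ → 0` at `∂(ℍ ∖ K)` (`tendsto_im_nhdsWithin`);
* the **Schwarz reflection** `reflExt φ` across `ℝ ∖ B̄(x, r)` when `K ∩ ℍ ⊆ B̄(x, r)`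
  (`differentiableOn_reflExt`, via `Complex.differentiableOn_schwarzReflection` and the local
  extension package `Complex.exists_differentiableOn_extension_of_im_le`), hydrodynamic at `∞`
  in the sense of `Literature.Analysis.Complex.IsHydrodynamicAt` (`isHydrodynamicAt_reflExt`);
* the **half-plane capacity** `hcap K φ = lim z (φ(z) - z)` (`tendsto_mul_sub_self`), with
  `0 ≤ hcap ≤ 288 r²` (`hcap_nonneg`, `hcap_le`), **`hcap > 0` iff `K ∩ ℍ ≠ ∅`** (`hcap_pos`),
  the uniform bound **`|φ(z) - z| ≤ 580 r` on all of `ℍ ∖ K`** (`norm_sub_self_le`, Lawler's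
  (3.12) with a weaker constant: far field by Prop. 3.46, near field by a connectedness argument
  replacing the maximum principle), and the expansion of Prop. 3.46 about any real centre
  (`norm_sub_sub_div_le`);
* **quotient maps** `φ₂ ∘ φ₁⁻¹ : ℍ ∖ φ₁(K₂ ∖ K₁) → ℍ` for `ℍ ∖ K₂ ⊆ ℍ ∖ K₁` (`diffQuotient`, with image hull `diffImage φ₁ K₂ = φ₁(K₂ ∖ K₁)`),
  again hydrodynamic, with **`hcap = hcap₂ - hcap₁`** (`hcap_diffQuotient`; Lawler's
  (3.8)/(3.10)).

## References

* G. F. Lawler, *Conformally Invariant Processes in the Plane*, AMS (2005), §3.4 (Prop. 3.36,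
  Def. 3.37, (3.8)–(3.12), Prop. 3.46). [Lawler2005]
-/

noncomputable section

open Set Filter Topology Metric Bornology Complex
open UpperHalfPlane (upperHalfPlaneSet isOpen_upperHalfPlaneSet)
open Literature.Analysis.Complex
open scoped ComplexConjugate

namespace Literature.Probability.RandomPlanarGeometry

/-! ### Two topological lemmas -/

/-- The part of `ℍ` outside a closed disc centred on the real axis is (pre)connected: it is the
image of `(ρ, ∞) × (0, π)` under polar coordinates about `x`. [folklore] -/
theorem isPreconnected_upperHalfPlane_far (x ρ : ℝ) (hρ : 0 ≤ ρ) :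
    IsPreconnected {w : ℂ | 0 < w.im ∧ ρ < ‖w - x‖} := by
  have heq : {w : ℂ | 0 < w.im ∧ ρ < ‖w - x‖} =
      (fun p : ℝ × ℝ ↦ (x : ℂ) + p.1 * exp (p.2 * I)) '' (Ioi ρ ×ˢ Ioo 0 Real.pi) := by
    ext w
    constructor
    · rintro ⟨hw, hρw⟩
      have him : 0 < (w - x).im := by simpa using hw
      refine ⟨(‖w - x‖, arg (w - x)), ⟨hρw, ?_, ?_⟩, ?_⟩
      · rcases (arg_nonneg_iff.2 him.le).lt_or_eq with h | h
        · exact h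
        · exfalso
          have := arg_eq_zero_iff.1 h.symm
          linarith [this.2]
      · rcases (arg_le_pi (w - x)).lt_or_eq with h | h
        · exact h
        · exfalso
          have := arg_eq_pi_iff.1 h
          linarith [this.2]
      · simp only
        rw [norm_mul_exp_arg_mul_I]
        ring
    · rintro ⟨⟨s, θ⟩, ⟨hs, hθ0, hθπ⟩, rfl⟩
      simp only [mem_Ioi] at hs
      have hs0 : 0 < s := hρ.trans_lt hs
      refine ⟨?_, ?_⟩
      · simp only [add_im, ofReal_im, zero_add, mul_im, ofReal_re, ofReal_im, zero_mul, add_zero,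
          exp_ofReal_mul_I_im]
        exact mul_pos hs0 (Real.sin_pos_of_pos_of_lt_pi hθ0 hθπ)
      · rw [add_sub_cancel_left, norm_mul, norm_real, Real.norm_of_nonneg hs0.le,
          norm_exp_ofReal_mul_I, mul_one]
        exact hs
  rw [heq]
  refine (isPreconnected_Ioi.prod isPreconnected_Ioo).image _ (Continuous.continuousOn ?_)
  fun_prop

namespace ConformalEquiv

variable {U V : Set ℂ}

/-- The image of an open subset of the source of a conformal equivalence is open (open mapping
theorem, through `isOpen_target_holds` for the restricted equivalence). [folklore] -/
theorem isOpen_image_of_isOpen (φ : ConformalEquiv U V) {s : Set ℂ} (hs : IsOpen s) (hsU : s ⊆ U) :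
    IsOpen (φ '' s) := by
  have hmaps : MapsTo φ s (φ '' s) := mapsTo_image φ s
  have hmaps' : MapsTo φ.symm (φ '' s) s := by
    rintro _ ⟨z, hz, rfl⟩
    rw [φ.symm_apply_apply (hsU hz)]
    exact hz
  exact isOpen_target_holds (φ.restr s (φ '' s) hsU (image_subset_iff.2 fun z hz ↦ φ.mapsTo (hsU hz))
    hmaps hmaps') hs

end ConformalEquiv

/-! ### Hydrodynamic normalization -/

/-- **Hydrodynamic normalization** of a conformal map `φ : ℍ ∖ K → ℍ`: `φ(z) - z → 0` as
`z → ∞` in `ℍ ∖ K` (Lawler (2005), Prop. 3.36: `g_A` is "the unique conformal transformation of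
`ℍ ∖ A` onto `ℍ` such that `lim_{z → ∞} (g_A(z) - z) = 0`"). [cite: Lawler2005, §3.4 Prop. 3.36] -/
def IsHydrodynamicMap (K : Set ℂ) (φ : ConformalEquiv (upperHalfPlaneSet \ K) upperHalfPlaneSet) :
    Prop :=
  Tendsto (fun z ↦ φ z - z) (cocompact ℂ ⊓ 𝓟 (upperHalfPlaneSet \ K)) (𝓝 0)

namespace IsHydrodynamicMap

variable {K : Set ℂ} {φ : ConformalEquiv (upperHalfPlaneSet \ K) upperHalfPlaneSet}

/-- The source `ℍ ∖ K` is open (source of a conformal equivalence onto the open `ℍ`). [folklore] -/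
theorem isOpen_diff (φ : ConformalEquiv (upperHalfPlaneSet \ K) upperHalfPlaneSet) :
    IsOpen (upperHalfPlaneSet \ K) :=
  φ.isOpen_source isOpen_upperHalfPlaneSet

/-- Quantitative form of the normalization: `|φ(z) - z| < ε` for `|z| ≥ R`. [folklore] -/
theorem exists_forall_norm_sub_lt (hφ : IsHydrodynamicMap K φ) {ε : ℝ} (hε : 0 < ε) :
    ∃ R : ℝ, ∀ z ∈ upperHalfPlaneSet \ K, R ≤ ‖z‖ → ‖φ z - z‖ < ε := by
  have h1 : ∀ᶠ z in cocompact ℂ ⊓ 𝓟 (upperHalfPlaneSet \ K), dist (φ z - z) 0 < ε :=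
    hφ (ball_mem_nhds _ hε)
  rw [← cobounded_eq_cocompact, (hasBasis_cobounded_norm.inf_principal _).eventually_iff] at h1
  obtain ⟨R, -, hR⟩ := h1
  refine ⟨R + 1, fun z hz hzR ↦ ?_⟩
  have := hR ⟨by simp; linarith, hz⟩
  simpa using this

/-- Points `t i` high up on the imaginary axis lie in `ℍ ∖ K` when `K ∩ ℍ` is bounded. [folklore] -/
theorem exists_forall_mul_I_mem (hb : IsBounded (K ∩ upperHalfPlaneSet)) :
    ∃ R₁ : ℝ, 0 ≤ R₁ ∧ ∀ z ∈ upperHalfPlaneSet, R₁ < ‖z‖ → z ∈ upperHalfPlaneSet \ K := by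
  obtain ⟨R₁, hR₁⟩ := hb.subset_closedBall 0
  refine ⟨max R₁ 0, le_max_right _ _, fun z hz hzR ↦ ⟨hz, fun hzK ↦ ?_⟩⟩
  have := hR₁ ⟨hzK, hz⟩
  rw [mem_closedBall, dist_zero_right] at this
  linarith [le_max_left R₁ 0]

/-- **Bounded parts go to bounded parts**: if `|φ(z) - z| < 1` for `|z| ≥ R₀` and the points of
`ℍ` of modulus `> R₁` are off `K`, then `|z| ≤ R ⇒ |φ(z)| ≤ R + 1` for every
`R ≥ max(R₀, R₁, 0)`. The far region `S = {w ∈ ℍ : |w| > R + 1}` is connected and covered by the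
two disjoint open sets `φ({|z| > R})`, `φ({|z| < R})` (the circle `|z| = R` is mapped into
`|w| ≤ R + 1`); it meets the first, hence misses the second. [folklore] -/
theorem norm_le_of_norm_le {R₀ R₁ : ℝ}
    (h₀ : ∀ z ∈ upperHalfPlaneSet \ K, R₀ ≤ ‖z‖ → ‖φ z - z‖ < 1)
    (h₁ : ∀ z ∈ upperHalfPlaneSet, R₁ < ‖z‖ → z ∈ upperHalfPlaneSet \ K)
    {R : ℝ} (hR : R₀ ≤ R) (hR1 : R₁ ≤ R) (hR0 : 0 ≤ R) {z : ℂ} (hz : z ∈ upperHalfPlaneSet \ K)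
    (hzR : ‖z‖ ≤ R) : ‖φ z‖ ≤ R + 1 := by
  by_contra hcon
  rw [not_le] at hcon
  set S : Set ℂ := {w : ℂ | 0 < w.im ∧ R + 1 < ‖w - ((0 : ℝ) : ℂ)‖} with hS
  have hSc : IsPreconnected S := isPreconnected_upperHalfPlane_far 0 (R + 1) (by linarith)
  have hmemS : ∀ {w : ℂ}, w ∈ S ↔ 0 < w.im ∧ R + 1 < ‖w‖ := fun {w} ↦ by simp [hS]
  set O : Set ℂ := {z ∈ upperHalfPlaneSet \ K | R < ‖z‖} with hO
  set N : Set ℂ := {z ∈ upperHalfPlaneSet \ K | ‖z‖ < R} with hN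
  have hOo : IsOpen O := (isOpen_diff φ).inter (isOpen_lt continuous_const continuous_norm)
  have hNo : IsOpen N := (isOpen_diff φ).inter (isOpen_lt continuous_norm continuous_const)
  have hO' : IsOpen (φ '' O) := φ.isOpen_image_of_isOpen hOo (sep_subset _ _)
  have hN' : IsOpen (φ '' N) := φ.isOpen_image_of_isOpen hNo (sep_subset _ _)
  have hcover : S ⊆ φ '' O ∪ φ '' N := by
    intro w hw
    rw [hmemS] at hw
    have hwH : w ∈ upperHalfPlaneSet := hw.1
    obtain ⟨y, hy, rfl⟩ : w ∈ φ '' (upperHalfPlaneSet \ K) := by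
      rw [φ.bijOn.image_eq]; exact hwH
    rcases lt_trichotomy R ‖y‖ with h | h | h
    · exact Or.inl ⟨y, ⟨hy, h⟩, rfl⟩
    · exfalso
      have h1 := h₀ y hy (by rw [← h]; exact hR)
      have h3 : ‖φ y‖ ≤ ‖φ y - y‖ + ‖y‖ := norm_le_norm_sub_add _ _
      linarith [hw.2]
    · exact Or.inr ⟨y, ⟨hy, h⟩, rfl⟩
  have hdisj : Disjoint (φ '' O) (φ '' N) := by
    rw [Set.disjoint_left]
    rintro _ ⟨y, hy, rfl⟩ ⟨y', hy', heq⟩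
    have : y' = y := φ.injOn hy'.1 hy.1 heq
    rw [this] at hy'
    linarith [hy.2, hy'.2]
  have hSO : (S ∩ φ '' O).Nonempty := by
    set M : ℝ := max R₀ 0 + R + 3 with hM
    have hMpos : 0 < M := by rw [hM]; linarith [le_max_right R₀ 0]
    set y : ℂ := (M : ℂ) * I with hy
    have hyn : ‖y‖ = M := by
      rw [hy, norm_mul, norm_real, norm_I, mul_one, Real.norm_of_nonneg hMpos.le]
    have hyH : y ∈ upperHalfPlaneSet := by
      show 0 < y.im; rw [hy]; simpa using hMpos
    have hyK : y ∈ upperHalfPlaneSet \ K := h₁ y hyH (by rw [hyn, hM]; linarith [le_max_right R₀ 0])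
    have hyO : y ∈ O := ⟨hyK, by rw [hyn, hM]; linarith [le_max_right R₀ 0]⟩
    have h1 := h₀ y hyK (by rw [hyn, hM]; linarith [le_max_left R₀ 0])
    refine ⟨φ y, ?_, ⟨y, hyO, rfl⟩⟩
    rw [hmemS]
    refine ⟨φ.mapsTo hyK, ?_⟩
    have h3 : ‖y‖ ≤ ‖φ y - y‖ + ‖φ y‖ := by
      have := norm_sub_le y (φ y); rw [norm_sub_rev] at this
      linarith [norm_le_norm_sub_add y (φ y), norm_sub_rev y (φ y)]
    rw [hyn, hM] at h3
    linarith [le_max_right R₀ 0]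
  rcases hSc.subset_or_subset hO' hN' hdisj hcover with h | h
  · have hzS : φ z ∈ S := by rw [hmemS]; exact ⟨φ.mapsTo hz, hcon⟩
    obtain ⟨y, hy, hyz⟩ := h hzS
    have : y = z := φ.injOn hy.1 hz hyz
    rw [this] at hy
    linarith [hy.2]
  · obtain ⟨w, hwS, hwO⟩ := hSO
    exact Set.disjoint_left.1 hdisj hwO (h hwS)

/-- **Properness**: bounded parts of `ℍ ∖ K` have bounded images, quantitatively. [folklore] -/
theorem exists_norm_le (hφ : IsHydrodynamicMap K φ) (hb : IsBounded (K ∩ upperHalfPlaneSet)) :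
    ∃ R₂ : ℝ, 0 ≤ R₂ ∧ ∀ R : ℝ, R₂ ≤ R →
      ∀ z ∈ upperHalfPlaneSet \ K, ‖z‖ ≤ R → ‖φ z‖ ≤ R + 1 := by
  obtain ⟨R₀, h₀⟩ := hφ.exists_forall_norm_sub_lt one_pos
  obtain ⟨R₁, hR₁, h₁⟩ := exists_forall_mul_I_mem hb
  refine ⟨max R₀ R₁, le_max_of_le_right hR₁, fun R hR z hz hzR ↦ ?_⟩
  exact norm_le_of_norm_le h₀ h₁ ((le_max_left _ _).trans hR) ((le_max_right _ _).trans hR)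
    (hR₁.trans ((le_max_right _ _).trans hR)) hz hzR

/-- **The inverse is hydrodynamically normalized too**: `φ⁻¹(w) - w → 0` as `w → ∞` in `ℍ`.
[folklore] -/
theorem tendsto_symm_sub_self (hφ : IsHydrodynamicMap K φ) (hb : IsBounded (K ∩ upperHalfPlaneSet)) :
    Tendsto (fun w ↦ φ.symm w - w) (cocompact ℂ ⊓ 𝓟 upperHalfPlaneSet) (𝓝 0) := by
  obtain ⟨R₂, hR₂, h₂⟩ := hφ.exists_norm_le hb
  rw [Metric.tendsto_nhds]
  intro ε hε
  obtain ⟨Rε, hε'⟩ := hφ.exists_forall_norm_sub_lt hε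
  set R : ℝ := max R₂ Rε with hR
  rw [← cobounded_eq_cocompact, (hasBasis_cobounded_norm.inf_principal _).eventually_iff]
  refine ⟨R + 2, trivial, ?_⟩
  rintro w ⟨hw, hwH⟩
  simp only [mem_setOf_eq] at hw
  have hz : φ.symm w ∈ upperHalfPlaneSet \ K := φ.symm_mapsTo hwH
  have hzR : R ≤ ‖φ.symm w‖ := by
    by_contra hlt
    rw [not_le] at hlt
    have := h₂ R (le_max_left _ _) _ hz hlt.le
    rw [φ.apply_symm_apply hwH] at this
    linarith
  have h1 := hε' _ hz ((le_max_right _ _).trans hzR)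
  rw [φ.apply_symm_apply hwH] at h1
  rw [dist_zero_right, norm_sub_rev]
  exact h1

/-- **`Im φ(z) ≤ Im z`** on `ℍ ∖ K` (Lawler (2005), §3.4: "`Im[g_A(z) - z]` … nonpositive";
here from the boundary Julia lemma at `∞` for the self-map `φ⁻¹` of `ℍ`). [cite: Lawler2005, §3.4 (3.7)] -/
theorem im_le (hφ : IsHydrodynamicMap K φ) (hb : IsBounded (K ∩ upperHalfPlaneSet)) {z : ℂ}
    (hz : z ∈ upperHalfPlaneSet \ K) : (φ z).im ≤ z.im := by
  have key := Complex.im_le_im_of_tendsto_sub_self φ.symm.differentiableOn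
    (fun w hw ↦ (φ.symm_mapsTo hw).1) (hφ.tendsto_symm_sub_self hb) (φ.mapsTo hz)
  rwa [φ.symm_apply_apply hz] at key

/-- `0 < Im φ(z)`. [folklore] -/
theorem im_pos {z : ℂ} (hz : z ∈ upperHalfPlaneSet \ K) : 0 < (φ z).im := φ.mapsTo hz

/-- **Boundary behaviour**: `Im φ(z) → 0` as `z → k` within `ℍ ∖ K`, for every `k ∉ ℍ ∖ K`
(the homeomorphism `φ : ℍ ∖ K → ℍ` is proper: a cluster value in `ℍ` would pull back to a
point of `ℍ ∖ K`). [folklore] -/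
theorem tendsto_im_nhdsWithin (hφ : IsHydrodynamicMap K φ) (hb : IsBounded (K ∩ upperHalfPlaneSet))
    {k : ℂ} (hk : k ∉ upperHalfPlaneSet \ K) :
    Tendsto (fun z ↦ (φ z).im) (𝓝[upperHalfPlaneSet \ K] k) (𝓝 0) := by
  obtain ⟨R₂, hR₂, h₂⟩ := hφ.exists_norm_le hb
  set M : ℝ := max R₂ (‖k‖ + 1) + 1 with hM
  rw [Metric.tendsto_nhds]
  intro ε hε
  -- the compact set `C = {w ∈ ℍ̄ : ε ≤ Im w, |w| ≤ M}` and its compact image under `φ⁻¹`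
  set C : Set ℂ := {w : ℂ | ε ≤ w.im} ∩ closedBall 0 M with hC
  have hCc : IsCompact C :=
    (isCompact_closedBall 0 M).inter_left (isClosed_le continuous_const continuous_im)
  have hCH : C ⊆ upperHalfPlaneSet := fun w hw ↦ show 0 < w.im from hε.trans_le hw.1
  have hC' : IsCompact (φ.symm '' C) := hCc.image_of_continuousOn (φ.symm.continuousOn.mono hCH)
  have hkC : k ∉ φ.symm '' C := by
    rintro ⟨w, hw, rfl⟩
    exact hk (φ.symm_mapsTo (hCH hw))
  have hev : ∀ᶠ z in 𝓝[upperHalfPlaneSet \ K] k, z ∉ φ.symm '' C ∧ ‖z‖ < ‖k‖ + 1 := by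
    have h1 : (φ.symm '' C)ᶜ ∈ 𝓝 k := hC'.isClosed.isOpen_compl.mem_nhds hkC
    have h2 : ball k 1 ∈ 𝓝 k := ball_mem_nhds k one_pos
    filter_upwards [mem_nhdsWithin_of_mem_nhds h1, mem_nhdsWithin_of_mem_nhds h2] with z hz hz'
    refine ⟨hz, ?_⟩
    rw [mem_ball, dist_eq_norm] at hz'
    linarith [norm_le_norm_sub_add z k, norm_sub_rev z k]
  filter_upwards [hev, self_mem_nhdsWithin] with z ⟨hz, hzk⟩ hzK
  rw [dist_zero_right, Real.norm_of_nonneg (im_pos hzK).le]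
  by_contra hcon
  rw [not_lt] at hcon
  apply hz
  refine ⟨φ z, ⟨hcon, ?_⟩, φ.symm_apply_apply hzK⟩
  rw [mem_closedBall, dist_zero_right]
  have := h₂ (max R₂ (‖k‖ + 1)) (le_max_left _ _) z hzK (hzk.le.trans (le_max_right _ _))
  rw [hM]; exact this

/-! ### The Schwarz reflection of `φ` across `ℝ ∖ B̄(x, r)` -/

/-- The **reflected map** of `φ : ℍ ∖ K → ℍ`: the boundary extension of `φ` to `ℍ̄` (limits
from inside `ℍ ∖ K`), reflected to the lower half-plane by `z ↦ conj φ(z̄)`. [folklore] -/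
def reflExt (φ : ConformalEquiv (upperHalfPlaneSet \ K) upperHalfPlaneSet) : ℂ → ℂ :=
  schwarzReflection (extendFrom (upperHalfPlaneSet \ K) φ)

/-- On `ℍ ∖ K` the reflected map is `φ`. [folklore] -/
theorem reflExt_eq {z : ℂ} (hz : z ∈ upperHalfPlaneSet \ K) : reflExt φ z = φ z := by
  rw [reflExt, schwarzReflection_of_nonneg (le_of_lt hz.1)]
  exact extendFrom_extends φ.continuousOn z hz

/-- Below the real axis the reflected map is `conj ∘ φ ∘ conj`. [folklore] -/
theorem reflExt_of_im_neg {z : ℂ} (hz : z.im < 0) (hzK : conj z ∈ upperHalfPlaneSet \ K) :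
    reflExt φ z = conj (φ (conj z)) := by
  rw [reflExt, schwarzReflection_of_neg hz, extendFrom_extends φ.continuousOn _ hzK]

section Reflection

variable {x r : ℝ}

/-- The upper exterior `{|z - x| > r, Im z > 0}` lies in `ℍ ∖ K`. [folklore] -/
theorem mem_diff_of_lt (hK : K ∩ upperHalfPlaneSet ⊆ closedBall (x : ℂ) r) {z : ℂ}
    (hz : r < ‖z - x‖) (hzi : 0 < z.im) : z ∈ upperHalfPlaneSet \ K := by
  refine ⟨hzi, fun hzK ↦ ?_⟩
  have := hK ⟨hzK, hzi⟩
  rw [mem_closedBall, dist_eq_norm] at this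
  linarith

/-- `K ∩ ℍ ⊆ B̄(x, r)` makes `K ∩ ℍ` bounded. [folklore] -/
theorem isBounded_of_subset (hK : K ∩ upperHalfPlaneSet ⊆ closedBall (x : ℂ) r) :
    IsBounded (K ∩ upperHalfPlaneSet) :=
  isBounded_closedBall.subset hK

/-- **Boundary limits at real points off `B̄(x, r)`**: `φ` has a limit at every real `ξ` with
`|ξ - x| > r` (it is `2`-Lipschitz on a half-disc at `ξ`, `Complex.exists_differentiableOn_extension_of_im_le`).
[folklore] -/
theorem exists_tendsto_ofReal (hφ : IsHydrodynamicMap K φ)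
    (hK : K ∩ upperHalfPlaneSet ⊆ closedBall (x : ℂ) r) {ξ : ℝ} (hξ : r < ‖(ξ : ℂ) - x‖) :
    ∃ y : ℂ, Tendsto φ (𝓝[upperHalfPlaneSet \ K] ξ) (𝓝 y) ∧ y.im = 0 := by
  set ρ : ℝ := ‖(ξ : ℂ) - x‖ - r with hρ
  have hρ0 : 0 < ρ := by rw [hρ]; linarith
  have hsub : ball (ξ : ℂ) ρ ∩ {z : ℂ | 0 < z.im} ⊆ upperHalfPlaneSet \ K := by
    rintro z ⟨hz, hzi⟩
    refine mem_diff_of_lt hK ?_ hzi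
    rw [mem_ball, dist_eq_norm] at hz
    have : ‖(ξ : ℂ) - x‖ ≤ ‖(ξ : ℂ) - z‖ + ‖z - x‖ := norm_sub_le_norm_sub_add_norm_sub _ _ _
    rw [norm_sub_rev] at hz
    linarith
  have hd : DifferentiableOn ℂ φ (ball (ξ : ℂ) ρ ∩ {z : ℂ | 0 < z.im}) :=
    φ.differentiableOn.mono hsub
  have him : ∀ z ∈ ball (ξ : ℂ) ρ ∩ {z : ℂ | 0 < z.im}, 0 < (φ z).im ∧ (φ z).im ≤ z.im :=
    fun z hz ↦ ⟨im_pos (hsub hz), hφ.im_le (isBounded_of_subset hK) (hsub hz)⟩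
  obtain ⟨G, hGd, hGeq, hGreal, -, -⟩ := Complex.exists_differentiableOn_extension_of_im_le hd him
  have hξmem : (ξ : ℂ) ∈ ball (ξ : ℂ) (ρ / 2) := mem_ball_self (by positivity)
  have hGc : ContinuousAt G ξ := (hGd.differentiableAt (isOpen_ball.mem_nhds hξmem)).continuousAt
  refine ⟨G ξ, ?_, hGreal _ hξmem (ofReal_im ξ)⟩
  -- `𝓝[ℍ ∖ K] ξ = 𝓝[ball ∩ ℍ] ξ` and `φ = G` there
  have hset : (upperHalfPlaneSet \ K) ∩ ball (ξ : ℂ) (ρ / 2) = ball (ξ : ℂ) (ρ / 2) ∩ {z | 0 < z.im} := by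
    ext z
    constructor
    · rintro ⟨hz, hzb⟩; exact ⟨hzb, hz.1⟩
    · rintro ⟨hzb, hzi⟩
      exact ⟨hsub ⟨ball_subset_ball (by linarith) hzb, hzi⟩, hzb⟩
  rw [nhdsWithin_restrict' (upperHalfPlaneSet \ K) (ball_mem_nhds (ξ : ℂ) (by positivity : 0 < ρ / 2)),
    hset]
  have h1 : Tendsto G (𝓝[ball (ξ : ℂ) (ρ / 2) ∩ {z | 0 < z.im}] ξ) (𝓝 (G ξ)) :=
    hGc.tendsto.mono_left nhdsWithin_le_nhds
  exact h1.congr' (eventually_nhdsWithin_of_forall fun z hz ↦ hGeq hz)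

/-- The closed upper exterior lies in the closure of `ℍ ∖ K`. [folklore] -/
theorem mem_closure_diff (hK : K ∩ upperHalfPlaneSet ⊆ closedBall (x : ℂ) r) {w : ℂ}
    (hw : r < ‖w - x‖) (hwi : 0 ≤ w.im) : w ∈ closure (upperHalfPlaneSet \ K) := by
  rw [Metric.mem_closure_iff]
  intro ε hε
  -- the point `w + i t` for small `t > 0`
  obtain ⟨t, ht0, htε, htr⟩ : ∃ t : ℝ, 0 < t ∧ t < ε ∧ t < ‖w - x‖ - r := by
    refine ⟨min (ε / 2) ((‖w - x‖ - r) / 2), ?_, ?_, ?_⟩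
    · exact lt_min (by positivity) (by linarith)
    · exact (min_le_left _ _).trans_lt (by linarith)
    · exact (min_le_right _ _).trans_lt (by linarith)
  refine ⟨w + t * I, mem_diff_of_lt hK ?_ ?_, ?_⟩
  · have : ‖w - x‖ ≤ ‖w + t * I - x‖ + ‖(t : ℂ) * I‖ := by
      have := norm_sub_le_norm_sub_add_norm_sub (w - x) (-(t * I)) 0
      have h1 : ‖w + ↑t * I - ↑x‖ = ‖(w - x) - (-(t * I))‖ := by ring_nf
      rw [h1]
      simpa using norm_le_norm_sub_add (w - x) (-(t * I))
    rw [norm_mul, norm_real, norm_I, mul_one, Real.norm_of_nonneg ht0.le] at this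
    linarith
  · simpa using add_pos_of_nonneg_of_pos hwi ht0
  · rw [dist_eq_norm]
    have : w - (w + t * I) = -(t * I) := by ring
    rw [this, norm_neg, norm_mul, norm_real, norm_I, mul_one, Real.norm_of_nonneg ht0.le]
    exact htε

/-- **The reflected map is holomorphic on `{|z - x| > r}`** (Schwarz reflection principle).
[cite: Lawler2005, §3.4 proof of Prop. 3.36 (Schwarz reflection)] -/
theorem differentiableOn_reflExt (hφ : IsHydrodynamicMap K φ)
    (hK : K ∩ upperHalfPlaneSet ⊆ closedBall (x : ℂ) r) :
    DifferentiableOn ℂ (reflExt φ) {z : ℂ | r < ‖z - x‖} := by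
  set U : Set ℂ := {z : ℂ | r < ‖z - x‖} with hU
  have hUo : IsOpen U := isOpen_lt continuous_const (continuous_norm.comp (continuous_id.sub continuous_const))
  have hsymm : ∀ z ∈ U, conj z ∈ U := fun z hz ↦ by
    show r < ‖conj z - x‖
    rw [← conj_ofReal x, ← map_sub, norm_conj]; exact hz
  refine Complex.differentiableOn_schwarzReflection hUo hsymm ?_ ?_ ?_
  · -- continuity of the boundary extension on `U ∩ {Im ≥ 0}`
    refine continuousOn_extendFrom (fun w hw ↦ mem_closure_diff hK hw.1 hw.2) fun w hw ↦ ?_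
    rcases (show 0 ≤ w.im from hw.2).lt_or_eq with hwi | hwi
    · exact ⟨φ w, φ.continuousOn.continuousWithinAt (mem_diff_of_lt hK hw.1 hwi)⟩
    · have hw' : w = ((w.re : ℝ) : ℂ) := Complex.ext (by simp) (by simp [hwi])
      have hξ : r < ‖((w.re : ℝ) : ℂ) - x‖ := by rw [← hw']; exact hw.1
      obtain ⟨y, hy, -⟩ := hφ.exists_tendsto_ofReal hK hξ
      exact ⟨y, by rw [hw']; exact hy⟩
  · refine φ.differentiableOn.mono ?_ |>.congr fun z hz ↦ ?_
    · exact fun z hz ↦ mem_diff_of_lt hK hz.1 hz.2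
    · exact extendFrom_extends φ.continuousOn z (mem_diff_of_lt hK hz.1 hz.2)
  · intro w hw hwi
    have hw' : w = ((w.re : ℝ) : ℂ) := Complex.ext (by simp) (by simp [hwi])
    have hξ : r < ‖((w.re : ℝ) : ℂ) - x‖ := by rw [← hw']; exact hw
    obtain ⟨y, hy, hyim⟩ := hφ.exists_tendsto_ofReal hK hξ
    rw [hw', extendFrom_eq (mem_closure_diff hK hξ (by simp)) hy]
    exact conj_eq_iff_im.2 hyim

/-- The reflected map is real on `ℝ ∖ [x - r, x + r]`, and is the limit of `φ` there. [folklore] -/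
theorem tendsto_reflExt_ofReal (hφ : IsHydrodynamicMap K φ)
    (hK : K ∩ upperHalfPlaneSet ⊆ closedBall (x : ℂ) r) {ξ : ℝ} (hξ : r < ‖(ξ : ℂ) - x‖) :
    Tendsto φ (𝓝[upperHalfPlaneSet \ K] ξ) (𝓝 (reflExt φ ξ)) ∧ (reflExt φ ξ).im = 0 := by
  obtain ⟨y, hy, hyim⟩ := hφ.exists_tendsto_ofReal hK hξ
  have : reflExt φ ξ = y := by
    rw [reflExt, schwarzReflection_ofReal, extendFrom_eq (mem_closure_diff hK hξ (by simp)) hy]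
  rw [this]
  exact ⟨hy, hyim⟩

/-- The reflected map commutes with conjugation on `{|z - x| > r}`. [folklore] -/
theorem reflExt_conj (hφ : IsHydrodynamicMap K φ)
    (hK : K ∩ upperHalfPlaneSet ⊆ closedBall (x : ℂ) r) {z : ℂ} (hz : r < ‖z - x‖) :
    reflExt φ (conj z) = conj (reflExt φ z) := by
  rcases lt_trichotomy z.im 0 with hzi | hzi | hzi
  · have hcz : conj z ∈ upperHalfPlaneSet \ K :=
      mem_diff_of_lt hK (by rw [← conj_ofReal x, ← map_sub, norm_conj]; exact hz)
        (by rw [conj_im]; linarith)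
    rw [reflExt_of_im_neg hzi hcz, reflExt_eq hcz, conj_conj]
  · have hz' : z = ((z.re : ℝ) : ℂ) := Complex.ext (by simp) (by simp [hzi])
    have hξ : r < ‖((z.re : ℝ) : ℂ) - x‖ := by rw [← hz']; exact hz
    rw [hz', conj_ofReal]
    exact (conj_eq_iff_im.2 (hφ.tendsto_reflExt_ofReal hK hξ).2).symm
  · have hzK : z ∈ upperHalfPlaneSet \ K := mem_diff_of_lt hK hz hzi
    have hcc : conj (conj z) ∈ upperHalfPlaneSet \ K := by rw [conj_conj]; exact hzK
    rw [reflExt_of_im_neg (by rw [conj_im]; linarith) hcc, reflExt_eq hzK, conj_conj]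

/-- **The reflected map is hydrodynamic at `∞`** in the sense of
`Literature.Analysis.Complex.IsHydrodynamicAt`: holomorphic on `{|z - x| > r}`, `- id → 0` at
`∞` (in all directions), conjugation-symmetric, `Im ≤ Im` above. [cite: Lawler2005, §3.4 Prop. 3.36] -/
theorem isHydrodynamicAt_reflExt (hφ : IsHydrodynamicMap K φ)
    (hK : K ∩ upperHalfPlaneSet ⊆ closedBall (x : ℂ) r) (hr : 0 < r) :
    IsHydrodynamicAt (reflExt φ) x r where
  pos := hr
  differentiableOn := hφ.differentiableOn_reflExt hK
  tendsto_sub := by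
    rw [Metric.tendsto_nhds]
    intro ε hε
    obtain ⟨R, hR⟩ := hφ.exists_forall_norm_sub_lt (half_pos hε)
    set R' : ℝ := max R 0 + |x| + r + 2 with hR'
    rw [← cobounded_eq_cocompact, hasBasis_cobounded_norm.eventually_iff]
    refine ⟨R', trivial, fun w hw ↦ ?_⟩
    simp only [mem_setOf_eq] at hw
    rw [dist_zero_right]
    -- `|w - x| > r` and `|w| ≥ R`
    have hwx : r < ‖w - x‖ := by
      have h1 : ‖w‖ ≤ ‖w - x‖ + ‖(x : ℂ)‖ := norm_le_norm_sub_add w x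
      rw [norm_real, Real.norm_eq_abs] at h1
      rw [hR'] at hw
      linarith [le_max_right R 0]
    have hfar : ∀ z : ℂ, ‖w‖ - 1 ≤ ‖z‖ → z ∈ upperHalfPlaneSet \ K → ‖φ z - z‖ < ε / 2 :=
      fun z hz hzK ↦ hR z hzK (by rw [hR'] at hw; linarith [le_max_left R 0, abs_nonneg x])
    rcases lt_trichotomy w.im 0 with hwi | hwi | hwi
    · have hcw : conj w ∈ upperHalfPlaneSet \ K :=
        mem_diff_of_lt hK (by rw [← conj_ofReal x, ← map_sub, norm_conj]; exact hwx)
          (by rw [conj_im]; linarith)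
      rw [reflExt_of_im_neg hwi hcw]
      have : conj (φ (conj w)) - w = conj (φ (conj w) - conj w) := by simp
      rw [this, norm_conj]
      exact (hfar _ (by rw [norm_conj]; linarith) hcw).trans (half_lt_self hε)
    · -- real point: pass to the limit
      have hw' : w = ((w.re : ℝ) : ℂ) := Complex.ext (by simp) (by simp [hwi])
      have hξ : r < ‖((w.re : ℝ) : ℂ) - x‖ := by rw [← hw']; exact hwx
      have hlim := (hφ.tendsto_reflExt_ofReal hK hξ).1
      rw [← hw'] at hlim
      have hlim' : Tendsto (fun z ↦ φ z - z) (𝓝[upperHalfPlaneSet \ K] w) (𝓝 (reflExt φ w - w)) :=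
        hlim.sub (tendsto_id.mono_left nhdsWithin_le_nhds)
      have hev : ∀ᶠ z in 𝓝[upperHalfPlaneSet \ K] w, ‖φ z - z‖ ≤ ε / 2 := by
        have h1 : ball w 1 ∈ 𝓝 w := ball_mem_nhds w one_pos
        filter_upwards [mem_nhdsWithin_of_mem_nhds h1, self_mem_nhdsWithin] with z hz hzK
        refine (hfar z ?_ hzK).le
        rw [mem_ball, dist_eq_norm] at hz
        linarith [norm_le_norm_sub_add w z, norm_sub_rev w z]
      haveI : (𝓝[upperHalfPlaneSet \ K] w).NeBot :=
        mem_closure_iff_nhdsWithin_neBot.1 (mem_closure_diff hK hwx hwi.symm.le)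
      exact (le_of_tendsto hlim'.norm hev).trans_lt (half_lt_self hε)
    · have hwK : w ∈ upperHalfPlaneSet \ K := mem_diff_of_lt hK hwx hwi
      rw [reflExt_eq hwK]
      exact (hfar w (by linarith) hwK).trans (half_lt_self hε)
  map_conj := fun z hz ↦ hφ.reflExt_conj hK hz
  im_le := fun z hz hzi ↦ by
    rw [reflExt_eq (mem_diff_of_lt hK hz hzi)]
    exact hφ.im_le (isBounded_of_subset hK) (mem_diff_of_lt hK hz hzi)

end Reflection

/-! ### The filter at infinity in `ℍ ∖ K` -/

/-- The filter "`z → ∞` in `ℍ ∖ K`" is nontrivial (`K ∩ ℍ` bounded). [folklore] -/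
theorem neBot_cocompact_inf (hb : IsBounded (K ∩ upperHalfPlaneSet)) :
    (cocompact ℂ ⊓ 𝓟 (upperHalfPlaneSet \ K)).NeBot := by
  obtain ⟨R₁, hR₁, h₁⟩ := exists_forall_mul_I_mem hb
  refine (hasBasis_cocompact.inf_principal _).neBot_iff.2 fun {C} hC ↦ ?_
  obtain ⟨M, hM⟩ := hC.isBounded.subset_closedBall 0
  set t : ℝ := max M R₁ + 1 with ht
  have ht0 : 0 < t := by rw [ht]; linarith [le_max_right M R₁]
  set y : ℂ := (t : ℂ) * I with hy
  have hyn : ‖y‖ = t := by rw [hy, norm_mul, norm_real, norm_I, mul_one, Real.norm_of_nonneg ht0.le]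
  have hyH : y ∈ upperHalfPlaneSet := by show 0 < y.im; rw [hy]; simpa using ht0
  refine ⟨y, ?_, h₁ y hyH (by rw [hyn, ht]; linarith [le_max_right M R₁])⟩
  intro hyC
  have := hM hyC
  rw [mem_closedBall, dist_zero_right, hyn, ht] at this
  linarith [le_max_left M R₁]

end IsHydrodynamicMap

/-! ### The half-plane capacity -/

/-- **Half-plane capacity** of the conformal map `φ : ℍ ∖ K → ℍ`: `hcap = lim_{z → ∞} z (φ(z) - z)`
(Lawler (2005), Def. 3.37 and the expansion `g_A(z) = z + hcap(A)/z + O(|z|⁻²)`; the limit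
exists for hydrodynamically normalized `φ`, `IsHydrodynamicMap.tendsto_mul_sub_self`; junk
otherwise). [cite: Lawler2005, §3.4 Def. 3.37] -/
def hcap (K : Set ℂ) (φ : ConformalEquiv (upperHalfPlaneSet \ K) upperHalfPlaneSet) : ℝ :=
  (limUnder (cocompact ℂ ⊓ 𝓟 (upperHalfPlaneSet \ K)) (fun z ↦ z * (φ z - z))).re

namespace IsHydrodynamicMap

variable {K : Set ℂ} {φ : ConformalEquiv (upperHalfPlaneSet \ K) upperHalfPlaneSet} {x r : ℝ}

/-- `z (φ(z) - z) → hcapAt (reflExt φ) x` at `∞` in `ℍ ∖ K`. [folklore] -/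
theorem tendsto_mul_sub_self_hcapAt (hφ : IsHydrodynamicMap K φ)
    (hK : K ∩ upperHalfPlaneSet ⊆ closedBall (x : ℂ) r) (hr : 0 < r) :
    Tendsto (fun z ↦ z * (φ z - z)) (cocompact ℂ ⊓ 𝓟 (upperHalfPlaneSet \ K))
      (𝓝 (hcapAt (reflExt φ) x : ℂ)) := by
  have h1 := (hφ.isHydrodynamicAt_reflExt hK hr).tendsto_mul_sub_hcapAt.mono_left
    (inf_le_left (b := 𝓟 (upperHalfPlaneSet \ K)))
  have h2 : Tendsto (fun z ↦ (x : ℂ) * (φ z - z)) (cocompact ℂ ⊓ 𝓟 (upperHalfPlaneSet \ K)) (𝓝 0) := by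
    simpa using hφ.const_mul (x : ℂ)
  have h3 := h1.add h2
  rw [add_zero] at h3
  refine h3.congr' ?_
  filter_upwards [mem_inf_of_right (mem_principal_self _)] with z hz
  rw [reflExt_eq hz]; ring

/-- **`hcap = hcapAt (reflExt φ) x`** for every admissible centre and radius. [folklore] -/
theorem hcap_eq_hcapAt (hφ : IsHydrodynamicMap K φ)
    (hK : K ∩ upperHalfPlaneSet ⊆ closedBall (x : ℂ) r) (hr : 0 < r) :
    hcap K φ = hcapAt (reflExt φ) x := by
  haveI := neBot_cocompact_inf (isBounded_of_subset hK)
  rw [hcap, (hφ.tendsto_mul_sub_self_hcapAt hK hr).limUnder_eq, ofReal_re]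

/-- A bounded `K ∩ ℍ` lies in some admissible closed disc about `0`. [folklore] -/
theorem exists_subset_closedBall_zero (hb : IsBounded (K ∩ upperHalfPlaneSet)) :
    ∃ r : ℝ, 0 < r ∧ K ∩ upperHalfPlaneSet ⊆ closedBall ((0 : ℝ) : ℂ) r := by
  obtain ⟨R, hR⟩ := hb.subset_closedBall 0
  refine ⟨max R 1, by positivity, fun z hz ↦ ?_⟩
  have := hR hz
  rw [mem_closedBall] at this ⊢
  push_cast
  exact this.trans (le_max_left _ _)

/-- **`z (φ(z) - z) → hcap`** at `∞` in `ℍ ∖ K` (Lawler (2005), Def. 3.37). [cite: Lawler2005, §3.4 Def. 3.37] -/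
theorem tendsto_mul_sub_self (hφ : IsHydrodynamicMap K φ) (hb : IsBounded (K ∩ upperHalfPlaneSet)) :
    Tendsto (fun z ↦ z * (φ z - z)) (cocompact ℂ ⊓ 𝓟 (upperHalfPlaneSet \ K)) (𝓝 (hcap K φ : ℂ)) := by
  obtain ⟨r, hr, hK⟩ := exists_subset_closedBall_zero hb
  rw [hφ.hcap_eq_hcapAt hK hr]
  exact hφ.tendsto_mul_sub_self_hcapAt hK hr

/-- **`hcap ≥ 0`**. [cite: Lawler2005, §3.4 (3.8)] -/
theorem hcap_nonneg (hφ : IsHydrodynamicMap K φ) (hb : IsBounded (K ∩ upperHalfPlaneSet)) :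
    0 ≤ hcap K φ := by
  obtain ⟨r, hr, hK⟩ := exists_subset_closedBall_zero hb
  rw [hφ.hcap_eq_hcapAt hK hr]
  exact (hφ.isHydrodynamicAt_reflExt hK hr).hcapAt_nonneg

/-- **`hcap ≤ 288 r²`** when `K ∩ ℍ ⊆ B̄(x, r)` (Lawler (2005), (3.9): `hcap(A) ≤ rad(A)²`; weaker
constant, no monotonicity used). [cite: Lawler2005, §3.4 (3.9)] -/
theorem hcap_le (hφ : IsHydrodynamicMap K φ) (hK : K ∩ upperHalfPlaneSet ⊆ closedBall (x : ℂ) r)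
    (hr : 0 < r) : hcap K φ ≤ 288 * r ^ 2 := by
  rw [hφ.hcap_eq_hcapAt hK hr]
  exact (hφ.isHydrodynamicAt_reflExt hK hr).hcapAt_le fun z hz hzi ↦ by
    rw [reflExt_eq (mem_diff_of_lt hK hz hzi)]; exact (im_pos (mem_diff_of_lt hK hz hzi)).le

/-- `ℍ ∖ K` is connected (it is homeomorphic to `ℍ`). [folklore] -/
theorem isConnected_diff (φ : ConformalEquiv (upperHalfPlaneSet \ K) upperHalfPlaneSet) :
    IsConnected (upperHalfPlaneSet \ K) := by
  rw [← φ.symm.bijOn.image_eq]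
  exact ((convex_halfSpace_im_gt 0).isConnected ⟨I, by simp⟩ |>.image _
    φ.symm.continuousOn)

/-- **`hcap > 0` as soon as `K` meets `ℍ`** (Lawler (2005), (3.8): "if `A ∈ 𝒬`, `hcap(A) > 0`"):
if `hcap = 0` the reflected map is the identity near `∞`, hence `φ = id` on the connected
`ℍ ∖ K` (identity theorem), contradicting `φ(ℍ ∖ K) = ℍ`. [cite: Lawler2005, §3.4 (3.8)] -/
theorem hcap_pos (hφ : IsHydrodynamicMap K φ) (hb : IsBounded (K ∩ upperHalfPlaneSet))
    (hne : (K ∩ upperHalfPlaneSet).Nonempty) : 0 < hcap K φ := by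
  obtain ⟨r, hr, hK⟩ := exists_subset_closedBall_zero hb
  rw [hφ.hcap_eq_hcapAt hK hr]
  have hH := hφ.isHydrodynamicAt_reflExt hK hr
  rcases hH.hcapAt_nonneg.lt_or_eq with h | h
  · exact h
  exfalso
  have hid : ∀ z : ℂ, r < ‖z - ((0 : ℝ) : ℂ)‖ → reflExt φ z = z :=
    fun z hz ↦ hH.eq_self_of_hcapAt_eq_zero h.symm hz
  -- `φ = id` near `z₀ = (r + 1) i`
  set z₀ : ℂ := ((r + 1 : ℝ) : ℂ) * I with hz₀
  have hz₀i : z₀.im = r + 1 := by simp [hz₀]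
  have hball : ∀ z ∈ ball z₀ 1, r < ‖z - ((0 : ℝ) : ℂ)‖ ∧ 0 < z.im := by
    intro z hz
    rw [mem_ball, dist_eq_norm] at hz
    have h1 : |(z - z₀).im| ≤ ‖z - z₀‖ := abs_im_le_norm _
    rw [sub_im, hz₀i] at h1
    have h2 : r < z.im := by
      have := neg_abs_le (z.im - (r + 1)); linarith
    refine ⟨?_, by linarith⟩
    push_cast; rw [sub_zero]
    exact h2.trans_le ((le_abs_self _).trans (abs_im_le_norm z))
  have hz₀mem : z₀ ∈ upperHalfPlaneSet \ K := by
    have := hball z₀ (mem_ball_self one_pos)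
    exact mem_diff_of_lt hK this.1 this.2
  have hev : (φ : ℂ → ℂ) =ᶠ[𝓝 z₀] id := by
    filter_upwards [ball_mem_nhds z₀ one_pos] with z hz
    obtain ⟨h1, h2⟩ := hball z hz
    rw [id, ← reflExt_eq (mem_diff_of_lt hK h1 h2), hid z h1]
  have heq : EqOn φ id (upperHalfPlaneSet \ K) :=
    (φ.differentiableOn.analyticOnNhd (isOpen_diff φ)).eqOn_of_preconnected_of_eventuallyEq
      analyticOnNhd_id (isConnected_diff φ).isPreconnected hz₀mem hev
  obtain ⟨k, hkK, hkH⟩ := hne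
  obtain ⟨z, hz, hzk⟩ : k ∈ φ '' (upperHalfPlaneSet \ K) := by rw [φ.bijOn.image_eq]; exact hkH
  rw [heq hz, id] at hzk
  exact hz.2 (hzk ▸ hkK)

/-! ### Uniform bounds: Lawler's (3.12) and Prop. 3.46 -/

/-- Far field: `|φ(z) - z| ≤ 576 r` for `z ∈ ℍ`, `|z - x| ≥ 2r`. [cite: Lawler2005, §3.4 (3.12)] -/
theorem norm_sub_self_le_far (hφ : IsHydrodynamicMap K φ)
    (hK : K ∩ upperHalfPlaneSet ⊆ closedBall (x : ℂ) r) (hr : 0 < r) {z : ℂ}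
    (hz : z ∈ upperHalfPlaneSet) (h2 : 2 * r ≤ ‖z - x‖) : ‖φ z - z‖ ≤ 576 * r := by
  have hzK : z ∈ upperHalfPlaneSet \ K := mem_diff_of_lt hK (by linarith) hz
  rw [← reflExt_eq hzK]
  exact (hφ.isHydrodynamicAt_reflExt hK hr).norm_sub_self_le_of_im_nonneg (fun w hw hwi ↦ by
    rw [reflExt_eq (mem_diff_of_lt hK hw hwi)]; exact (im_pos (mem_diff_of_lt hK hw hwi)).le) h2

/-- Near field: `|φ(z) - x| ≤ 578 r` for `z ∈ ℍ ∖ K`, `|z - x| ≤ 2r`. The connected far region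
`{w ∈ ℍ : |w - x| > 578 r}` is covered by the disjoint open sets `φ({|z - x| > 2r})` and
`φ({|z - x| < 2r} ∖ K)` (the half-circle `|z - x| = 2r` is mapped within `578 r` of `x`), and
meets the first. (Lawler (2005) proves (3.12) by the maximum principle.) [cite: Lawler2005, §3.4 (3.12)] -/
theorem norm_sub_le_near (hφ : IsHydrodynamicMap K φ)
    (hK : K ∩ upperHalfPlaneSet ⊆ closedBall (x : ℂ) r) (hr : 0 < r) {z : ℂ}
    (hzK : z ∈ upperHalfPlaneSet \ K) (h2 : ‖z - x‖ ≤ 2 * r) : ‖φ z - x‖ ≤ 578 * r := by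
  by_contra hcon
  rw [not_le] at hcon
  set S : Set ℂ := {w : ℂ | 0 < w.im ∧ 578 * r < ‖w - x‖} with hS
  have hSc : IsPreconnected S := isPreconnected_upperHalfPlane_far x (578 * r) (by positivity)
  set O : Set ℂ := {z ∈ upperHalfPlaneSet \ K | 2 * r < ‖z - x‖} with hO
  set N : Set ℂ := {z ∈ upperHalfPlaneSet \ K | ‖z - x‖ < 2 * r} with hN
  have hcn : Continuous fun z : ℂ ↦ ‖z - x‖ := continuous_norm.comp (continuous_id.sub continuous_const)
  have hOo : IsOpen O := (isOpen_diff φ).inter (isOpen_lt continuous_const hcn)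
  have hNo : IsOpen N := (isOpen_diff φ).inter (isOpen_lt hcn continuous_const)
  have hO' : IsOpen (φ '' O) := φ.isOpen_image_of_isOpen hOo (sep_subset _ _)
  have hN' : IsOpen (φ '' N) := φ.isOpen_image_of_isOpen hNo (sep_subset _ _)
  have hcover : S ⊆ φ '' O ∪ φ '' N := by
    intro w hw
    have hwH : w ∈ upperHalfPlaneSet := hw.1
    obtain ⟨y, hy, rfl⟩ : w ∈ φ '' (upperHalfPlaneSet \ K) := by
      rw [φ.bijOn.image_eq]; exact hwH
    rcases lt_trichotomy (2 * r) ‖y - x‖ with h | h | h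
    · exact Or.inl ⟨y, ⟨hy, h⟩, rfl⟩
    · exfalso
      have h1 := hφ.norm_sub_self_le_far hK hr hy.1 h.le
      have h3 : ‖φ y - x‖ ≤ ‖φ y - y‖ + ‖y - x‖ := norm_sub_le_norm_sub_add_norm_sub _ _ _
      linarith [hw.2]
    · exact Or.inr ⟨y, ⟨hy, h⟩, rfl⟩
  have hdisj : Disjoint (φ '' O) (φ '' N) := by
    rw [Set.disjoint_left]
    rintro _ ⟨y, hy, rfl⟩ ⟨y', hy', heq⟩
    have : y' = y := φ.injOn hy'.1 hy.1 heq
    rw [this] at hy'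
    linarith [hy.2, hy'.2]
  have hSO : (S ∩ φ '' O).Nonempty := by
    set y : ℂ := (x : ℂ) + ((1156 * r : ℝ) : ℂ) * I with hy
    have hyx : ‖y - x‖ = 1156 * r := by
      rw [hy, add_sub_cancel_left, norm_mul, norm_real, norm_I, mul_one, Real.norm_of_nonneg (by positivity)]
    have hyH : y ∈ upperHalfPlaneSet := by show 0 < y.im; simp [hy]; positivity
    have hyK : y ∈ upperHalfPlaneSet \ K := mem_diff_of_lt hK (by rw [hyx]; linarith) hyH
    have hyO : y ∈ O := ⟨hyK, by rw [hyx]; linarith⟩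
    have h1 := hφ.norm_sub_self_le_far hK hr hyH (by rw [hyx]; linarith)
    refine ⟨φ y, ⟨φ.mapsTo hyK, ?_⟩, ⟨y, hyO, rfl⟩⟩
    have h3 : ‖y - x‖ ≤ ‖y - φ y‖ + ‖φ y - x‖ := norm_sub_le_norm_sub_add_norm_sub _ _ _
    rw [norm_sub_rev y (φ y), hyx] at h3
    linarith
  rcases hSc.subset_or_subset hO' hN' hdisj hcover with h | h
  · have hzS : φ z ∈ S := ⟨φ.mapsTo hzK, hcon⟩
    obtain ⟨y, hy, hyz⟩ := h hzS
    have : y = z := φ.injOn hy.1 hzK hyz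
    rw [this] at hy
    linarith [hy.2]
  · obtain ⟨w, hwS, hwO⟩ := hSO
    exact Set.disjoint_left.1 hdisj hwO (h hwS)

/-- **`|φ(z) - z| ≤ 580 r` on all of `ℍ ∖ K`** when `K ∩ ℍ ⊆ B̄(x, r)` (Lawler (2005), (3.12):
`|g_A(z) - z| ≤ 3 rad(A)`; weaker constant). [cite: Lawler2005, §3.4 (3.12)] -/
theorem norm_sub_self_le (hφ : IsHydrodynamicMap K φ)
    (hK : K ∩ upperHalfPlaneSet ⊆ closedBall (x : ℂ) r) (hr : 0 < r) {z : ℂ}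
    (hzK : z ∈ upperHalfPlaneSet \ K) : ‖φ z - z‖ ≤ 580 * r := by
  rcases le_or_gt (2 * r) ‖z - x‖ with h | h
  · exact (hφ.norm_sub_self_le_far hK hr hzK.1 h).trans (by linarith)
  · have h1 := hφ.norm_sub_le_near hK hr hzK h.le
    have h3 : ‖φ z - z‖ ≤ ‖φ z - x‖ + ‖x - z‖ := norm_sub_le_norm_sub_add_norm_sub _ _ _
    rw [norm_sub_rev (x : ℂ) z] at h3
    linarith

/-- **Prop. 3.46 about any real centre**: `|φ(z) - z - hcap/(z - x)| ≤ 6 hcap r/|z - x|²` for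
`z ∈ ℍ`, `|z - x| ≥ 2r`, when `K ∩ ℍ ⊆ B̄(x, r)`. [cite: Lawler2005, Prop. 3.46] -/
theorem norm_sub_sub_div_le (hφ : IsHydrodynamicMap K φ)
    (hK : K ∩ upperHalfPlaneSet ⊆ closedBall (x : ℂ) r) (hr : 0 < r) {z : ℂ}
    (hz : z ∈ upperHalfPlaneSet) (h2 : 2 * r ≤ ‖z - x‖) :
    ‖φ z - z - hcap K φ / (z - x)‖ ≤ 6 * hcap K φ * r / ‖z - x‖ ^ 2 := by
  have hzK : z ∈ upperHalfPlaneSet \ K := mem_diff_of_lt hK (by linarith) hz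
  rw [hφ.hcap_eq_hcapAt hK hr, ← reflExt_eq hzK]
  exact (hφ.isHydrodynamicAt_reflExt hK hr).norm_sub_sub_div_le' h2

end IsHydrodynamicMap

/-! ### Quotient maps `φ₂ ∘ φ₁⁻¹` -/

section Quotient

variable {K₁ K₂ : Set ℂ} {φ₁ : ConformalEquiv (upperHalfPlaneSet \ K₁) upperHalfPlaneSet}
  {φ₂ : ConformalEquiv (upperHalfPlaneSet \ K₂) upperHalfPlaneSet}

/-- The **image hull** `φ₁(K₂ ∖ K₁)` (its part in `ℍ`) of a pair of hulls `K₁ ⊆ K₂`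
(Lawler (2005), §3.4: `g_A(B ∖ A)` for hulls `A ⊆ B`, with `g_B = g_{g_A(B ∖ A)} ∘ g_A`).
[cite: Lawler2005, §3.4 (3.8)] -/
def diffImage (φ₁ : ConformalEquiv (upperHalfPlaneSet \ K₁) upperHalfPlaneSet) (K₂ : Set ℂ) :
    Set ℂ :=
  φ₁ '' ((upperHalfPlaneSet \ K₁) ∩ K₂)

/-- The image hull lies in `ℍ`. [folklore] -/
theorem diffImage_subset : diffImage φ₁ K₂ ⊆ upperHalfPlaneSet := by
  rintro _ ⟨z, hz, rfl⟩
  exact φ₁.mapsTo hz.1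

/-- `ℍ ∖ φ₁(K₂ ∖ K₁) = φ₁(ℍ ∖ K₂)` when `ℍ ∖ K₂ ⊆ ℍ ∖ K₁`. [folklore] -/
theorem diff_diffImage_eq (h12 : upperHalfPlaneSet \ K₂ ⊆ upperHalfPlaneSet \ K₁) :
    upperHalfPlaneSet \ diffImage φ₁ K₂ = φ₁ '' (upperHalfPlaneSet \ K₂) := by
  ext w
  constructor
  · rintro ⟨hw, hwQ⟩
    obtain ⟨z, hz, rfl⟩ : w ∈ φ₁ '' (upperHalfPlaneSet \ K₁) := by rw [φ₁.bijOn.image_eq]; exact hw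
    refine ⟨z, ⟨hz.1, fun hzK ↦ hwQ ⟨z, ⟨hz, hzK⟩, rfl⟩⟩, rfl⟩
  · rintro ⟨z, hz, rfl⟩
    refine ⟨φ₁.mapsTo (h12 hz), ?_⟩
    rintro ⟨z', hz', heq⟩
    have : z' = z := φ₁.injOn hz'.1 (h12 hz) heq
    rw [this] at hz'
    exact hz.2 hz'.2

/-- `φ₁⁻¹` maps `ℍ ∖ φ₁(K₂ ∖ K₁)` into `ℍ ∖ K₂`. [folklore] -/
theorem mapsTo_symm_diff_diffImage (h12 : upperHalfPlaneSet \ K₂ ⊆ upperHalfPlaneSet \ K₁) :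
    MapsTo φ₁.symm (upperHalfPlaneSet \ diffImage φ₁ K₂) (upperHalfPlaneSet \ K₂) := by
  intro w hw
  rw [diff_diffImage_eq h12] at hw
  obtain ⟨z, hz, rfl⟩ := hw
  rw [φ₁.symm_apply_apply (h12 hz)]
  exact hz

/-- `φ₁` maps `ℍ ∖ K₂` into `ℍ ∖ φ₁(K₂ ∖ K₁)`. [folklore] -/
theorem mapsTo_diff_diffImage (h12 : upperHalfPlaneSet \ K₂ ⊆ upperHalfPlaneSet \ K₁) :
    MapsTo φ₁ (upperHalfPlaneSet \ K₂) (upperHalfPlaneSet \ diffImage φ₁ K₂) := by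
  intro z hz
  rw [diff_diffImage_eq h12]
  exact ⟨z, hz, rfl⟩

/-- **The quotient map** `φ₂ ∘ φ₁⁻¹ : ℍ ∖ φ₁(K₂ ∖ K₁) → ℍ` (Lawler (2005), §3.4:
`g_{g_A(B∖A)} = g_B ∘ g_A⁻¹`; in Loewner theory `g_{s,t} = g_t ∘ g_s⁻¹`). [cite: Lawler2005, §3.4 (3.8)] -/
def diffQuotient (φ₁ : ConformalEquiv (upperHalfPlaneSet \ K₁) upperHalfPlaneSet)
    (φ₂ : ConformalEquiv (upperHalfPlaneSet \ K₂) upperHalfPlaneSet)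
    (h12 : upperHalfPlaneSet \ K₂ ⊆ upperHalfPlaneSet \ K₁) :
    ConformalEquiv (upperHalfPlaneSet \ diffImage φ₁ K₂) upperHalfPlaneSet :=
  (φ₁.symm.restr (upperHalfPlaneSet \ diffImage φ₁ K₂) (upperHalfPlaneSet \ K₂) sdiff_subset h12
    (mapsTo_symm_diff_diffImage h12) (mapsTo_diff_diffImage h12)).trans φ₂

/-- `(φ₂ ∘ φ₁⁻¹)(w) = φ₂ (φ₁⁻¹ w)`. [folklore] -/
@[simp] theorem diffQuotient_apply (h12 : upperHalfPlaneSet \ K₂ ⊆ upperHalfPlaneSet \ K₁) (w : ℂ) :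
    diffQuotient φ₁ φ₂ h12 w = φ₂ (φ₁.symm w) := rfl

/-- `(φ₂ ∘ φ₁⁻¹)(φ₁ z) = φ₂ z` on `ℍ ∖ K₂`. [folklore] -/
theorem diffQuotient_apply_apply (h12 : upperHalfPlaneSet \ K₂ ⊆ upperHalfPlaneSet \ K₁) {z : ℂ}
    (hz : z ∈ upperHalfPlaneSet \ K₂) : diffQuotient φ₁ φ₂ h12 (φ₁ z) = φ₂ z := by
  rw [diffQuotient_apply, φ₁.symm_apply_apply (h12 hz)]

/-- A map at bounded distance from the identity tends to `∞` with its argument. [folklore] -/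
theorem tendsto_cocompact_of_sub_self {l : Filter ℂ} {f : ℂ → ℂ} (hl : l ≤ cocompact ℂ)
    (h : Tendsto (fun w ↦ f w - w) l (𝓝 0)) : Tendsto f l (cocompact ℂ) := by
  rw [← cobounded_eq_cocompact, ← tendsto_norm_atTop_iff_cobounded]
  have h1 : Tendsto (fun w : ℂ ↦ ‖w‖ + -1) l atTop :=
    tendsto_atTop_add_const_right _ _ (tendsto_norm_cobounded_atTop.mono_left
      (by rwa [cobounded_eq_cocompact]))
  refine tendsto_atTop_mono' l ?_ h1
  have h2 : ∀ᶠ w in l, ‖f w - w‖ < 1 := by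
    have := h (ball_mem_nhds _ one_pos)
    filter_upwards [this] with w hw
    simpa using hw
  filter_upwards [h2] with w hw
  linarith [norm_le_norm_sub_add w (f w), norm_sub_rev w (f w)]

namespace IsHydrodynamicMap

/-- `φ₁⁻¹` tends to `∞` in `ℍ ∖ K₂` as its argument tends to `∞` in `ℍ ∖ φ₁(K₂ ∖ K₁)`. [folklore] -/
theorem tendsto_symm_quotient (h₁ : IsHydrodynamicMap K₁ φ₁) (hb₁ : IsBounded (K₁ ∩ upperHalfPlaneSet))
    (h12 : upperHalfPlaneSet \ K₂ ⊆ upperHalfPlaneSet \ K₁) :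
    Tendsto φ₁.symm (cocompact ℂ ⊓ 𝓟 (upperHalfPlaneSet \ diffImage φ₁ K₂))
      (cocompact ℂ ⊓ 𝓟 (upperHalfPlaneSet \ K₂)) := by
  refine tendsto_inf.2 ⟨?_, tendsto_principal.2 ?_⟩
  · refine tendsto_cocompact_of_sub_self inf_le_left ((h₁.tendsto_symm_sub_self hb₁).mono_left ?_)
    exact inf_le_inf_left _ (principal_mono.2 sdiff_subset)
  · filter_upwards [mem_inf_of_right (mem_principal_self _)] with w hw
    exact mapsTo_symm_diff_diffImage h12 hw

/-- **The quotient map is hydrodynamically normalized.** [cite: Lawler2005, §3.4 (3.8)] -/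
theorem diffQuotient (h₁ : IsHydrodynamicMap K₁ φ₁) (h₂ : IsHydrodynamicMap K₂ φ₂)
    (hb₁ : IsBounded (K₁ ∩ upperHalfPlaneSet)) (h12 : upperHalfPlaneSet \ K₂ ⊆ upperHalfPlaneSet \ K₁) :
    IsHydrodynamicMap (diffImage φ₁ K₂) (diffQuotient φ₁ φ₂ h12) := by
  have hA : Tendsto (fun z ↦ (φ₂ z - z) - (φ₁ z - z)) (cocompact ℂ ⊓ 𝓟 (upperHalfPlaneSet \ K₂)) (𝓝 0) := by
    have := h₂.sub (h₁.mono_left (inf_le_inf_left _ (principal_mono.2 h12)))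
    rwa [sub_zero] at this
  have hB := hA.comp (h₁.tendsto_symm_quotient hb₁ h12)
  refine hB.congr' ?_
  filter_upwards [mem_inf_of_right (mem_principal_self _)] with w hw
  simp only [Function.comp_apply, diffQuotient_apply, φ₁.apply_symm_apply hw.1]
  ring

/-- The image hull is bounded. [folklore] -/
theorem isBounded_diffImage (h₁ : IsHydrodynamicMap K₁ φ₁) (hb₁ : IsBounded (K₁ ∩ upperHalfPlaneSet))
    (hb₂ : IsBounded (K₂ ∩ upperHalfPlaneSet)) : IsBounded (diffImage φ₁ K₂ ∩ upperHalfPlaneSet) := by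
  obtain ⟨R₂, hR₂, h⟩ := h₁.exists_norm_le hb₁
  obtain ⟨M, hM⟩ := hb₂.subset_closedBall 0
  refine (isBounded_closedBall (x := (0 : ℂ)) (r := max R₂ M + 1)).subset ?_
  rintro _ ⟨⟨z, ⟨hz, hzK⟩, rfl⟩, -⟩
  rw [mem_closedBall, dist_zero_right]
  have hzM : ‖z‖ ≤ M := by simpa using hM ⟨hzK, hz.1⟩
  exact h (max R₂ M) (le_max_left _ _) z hz (hzM.trans (le_max_right _ _))

/-- **Additivity of the half-plane capacity**: `hcap(φ₂ ∘ φ₁⁻¹) = hcap(φ₂) - hcap(φ₁)` (Lawler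
(2005), (3.8)/(3.10): `hcap(A ∪ g_A⁻¹(B)) = hcap(A) + hcap(B)`; in Loewner theory
`hcap(g_s(γ(s, t])) = b(t) - b(s)`). [cite: Lawler2005, §3.4 (3.8)] -/
theorem hcap_diffQuotient (h₁ : IsHydrodynamicMap K₁ φ₁) (h₂ : IsHydrodynamicMap K₂ φ₂)
    (hb₁ : IsBounded (K₁ ∩ upperHalfPlaneSet)) (hb₂ : IsBounded (K₂ ∩ upperHalfPlaneSet))
    (h12 : upperHalfPlaneSet \ K₂ ⊆ upperHalfPlaneSet \ K₁) :
    hcap (diffImage φ₁ K₂) (RandomPlanarGeometry.diffQuotient φ₁ φ₂ h12) = hcap K₂ φ₂ - hcap K₁ φ₁ := by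
  set ψ := RandomPlanarGeometry.diffQuotient φ₁ φ₂ h12 with hψ
  have hQ := h₁.diffQuotient h₂ hb₁ h12
  have hbQ := h₁.isBounded_diffImage hb₁ hb₂ (K₂ := K₂)
  haveI := neBot_cocompact_inf hbQ
  have hlim := hQ.tendsto_mul_sub_self hbQ
  -- the same limit computed through `w = φ₁ z`
  set F₂ := cocompact ℂ ⊓ 𝓟 (upperHalfPlaneSet \ K₂) with hF₂
  have hd₁ : Tendsto (fun z ↦ φ₁ z - z) F₂ (𝓝 0) := h₁.mono_left (inf_le_inf_left _ (principal_mono.2 h12))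
  have hd₂ : Tendsto (fun z ↦ φ₂ z - z) F₂ (𝓝 0) := h₂
  have hm₁ : Tendsto (fun z ↦ z * (φ₁ z - z)) F₂ (𝓝 (hcap K₁ φ₁ : ℂ)) :=
    (h₁.tendsto_mul_sub_self hb₁).mono_left (inf_le_inf_left _ (principal_mono.2 h12))
  have hm₂ : Tendsto (fun z ↦ z * (φ₂ z - z)) F₂ (𝓝 (hcap K₂ φ₂ : ℂ)) := h₂.tendsto_mul_sub_self hb₂
  have hG : Tendsto (fun z ↦ φ₁ z * ((φ₂ z - z) - (φ₁ z - z))) F₂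
      (𝓝 ((hcap K₂ φ₂ : ℂ) - hcap K₁ φ₁)) := by
    have := (hm₂.sub hm₁).add ((hd₁.mul (hd₂.sub hd₁)))
    rw [show ((hcap K₂ φ₂ : ℂ) - hcap K₁ φ₁) + 0 * (0 - 0) = (hcap K₂ φ₂ : ℂ) - hcap K₁ φ₁ by ring] at this
    refine this.congr' (Eventually.of_forall fun z ↦ ?_)
    ring
  have hG' := hG.comp (h₁.tendsto_symm_quotient hb₁ h12)
  have hlim' : Tendsto (fun w ↦ w * (ψ w - w)) (cocompact ℂ ⊓ 𝓟 (upperHalfPlaneSet \ diffImage φ₁ K₂))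
      (𝓝 ((hcap K₂ φ₂ : ℂ) - hcap K₁ φ₁)) := by
    refine hG'.congr' ?_
    filter_upwards [mem_inf_of_right (mem_principal_self _)] with w hw
    simp only [Function.comp_apply, hψ, diffQuotient_apply, φ₁.apply_symm_apply hw.1]
    ring
  have := tendsto_nhds_unique hlim hlim'
  exact_mod_cast this

end IsHydrodynamicMap

end Quotient

end Literature.Probability.RandomPlanarGeometry
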